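import Literature.NumberTheory.EllipticCurves.DegreeConjectureAbcPrelims
import Literature.NumberTheory.EllipticCurves.RationalIsogenyFrobeniusCriterion
import HarnessLib

/-!
# Rank-2 observatory — the Tate–Kraus step at `q = 2` for global minimality

HONEST FRAMING: per-curve certified theorems and census instruments; no claim on BSD in rank ≥ 2.

The finite global-minimality criterion used by the observatory
(`Literature.NumberTheory.EllipticCurves.isGloballyMinimal_baseChange_int`: `q¹² ∤ Δ ∨ q ∤ c₄` for
every prime `q`, Silverman AEC VII.1 Remark 1.1) is silent for the `22` census curves of the
two-engine `p`-adic atlas with `2⁴ ∣ c₄` and `2¹² ∣ Δ`. For those the minimality of the census model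
at `2` is decided by the first step of Tate's algorithm in Kraus's form: an *integral* Weierstrass
equation over `ℤ₂` has `16 ∣ c₄` (if `a₁` is even) or `c₆ ≡ −1 (mod 4)` (if `a₁` is odd)
(`kraus_two_weak`, the easy half of Kraus's theorem at `2`); hence if `W₀ / ℤ` had an integral
`ℚ₂`-isomorphic equation with `ord₂ Δ' < ord₂ Δ`, i.e. `c₄' = c₄ / u⁴`, `c₆' = c₆ / u⁶` with
`ord₂ u ≥ 1`, then `2⁸ ∣ c₄`, or `u = 2η` with `η ∈ ℤ₂ˣ` and `2⁸ ∣ c₆ + 64` (as `η⁶ ≡ 1 mod 4`).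
So **`2⁸ ∤ c₄(W₀)` and `2⁸ ∤ c₆(W₀) + 64` imply that `W₀` is minimal at `2`**
(`isMinimal_padic_two_of_kraus`, `isMinimalAt_baseChange_int_two_of_kraus`), and together with the
`c₄`/`Δ` criterion at the odd primes, that `W₀ ⊗ ℚ` is a global minimal equation
(`isGloballyMinimal_baseChange_int_of_kraus`, with the finite check
`forall_odd_not_pow_dvd_or_of_bound`). No new definitions, no new axioms, no `sorry`.

References: A. Kraus, *Quelques remarques à propos des invariants c₄, c₆ et Δ d'une courbe
elliptique*, Acta Arith. 54 (1989) 75–80, Prop. 2; J. H. Silverman, *The Arithmetic of Elliptic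
Curves*, GTM 106 (2009), VII.1 Prop. 1.3, Remark 1.1, VIII.8; J. E. Cremona, *Algorithms for Modular
Elliptic Curves* (1997), §3.2 (Kraus's conditions, Tate's algorithm at `2`).
-/

-- single-conjunct summit: `Summit.BirchSwinnertonDyer.BirchSwinnertonDyer.…` repeats the name by design
set_option linter.dupNamespace false

namespace Summit.BirchSwinnertonDyer.BirchSwinnertonDyer.Rank2Observatory

open IsDedekindDomain WeierstrassCurve Literature.NumberTheory.EllipticCurves

/-! ### Parity in `ℤ₂` and Kraus's necessary condition at `2` -/

/-- Every `2`-adic integer is `2m` or `2m + 1` (the residue field of `ℤ₂` is `𝔽₂`). [folklore] -/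
theorem padicInt_two_exists_eq_two_mul_or (x : ℤ_[2]) : ∃ m : ℤ_[2], x = 2 * m ∨ x = 2 * m + 1 := by
  have key : ∀ y : ℤ_[2], PadicInt.toZMod y = 0 → (2 : ℤ_[2]) ∣ y := fun y hy => by
    have h : y ∈ RingHom.ker (PadicInt.toZMod (p := 2)) := (RingHom.mem_ker).mpr hy
    rw [PadicInt.ker_toZMod, PadicInt.maximalIdeal_eq_span_p, Ideal.mem_span_singleton] at h
    simpa using h
  rcases (by decide : ∀ z : ZMod 2, z = 0 ∨ z = 1) (PadicInt.toZMod x) with h | h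
  · obtain ⟨m, hm⟩ := key x h
    exact ⟨m, Or.inl hm⟩
  · have h' : PadicInt.toZMod (x - 1) = 0 := by rw [map_sub, map_one, h, sub_self]
    obtain ⟨m, hm⟩ := key _ h'
    exact ⟨m, Or.inr (by linear_combination hm)⟩

/-- **Kraus's condition at `2`, necessary half (weak form).** An integral Weierstrass equation over
`ℤ₂` has `16 ∣ c₄` (when `a₁` is even: `b₂ = 4(m² + a₂)`, `b₄ = 2(a₄ + m a₃)`) or `4 ∣ c₆ + 1`
(when `a₁ = 2m + 1`: `b₂ ≡ 1 (mod 4)`, so `c₆ ≡ −b₂³ ≡ −1 (mod 4)`). [cite: Kraus1989, Prop. 2] -/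
theorem kraus_two_weak (Y : WeierstrassCurve ℤ_[2]) :
    (16 : ℤ_[2]) ∣ Y.c₄ ∨ (4 : ℤ_[2]) ∣ Y.c₆ + 1 := by
  obtain ⟨m, hm | hm⟩ := padicInt_two_exists_eq_two_mul_or Y.a₁
  · refine Or.inl ⟨(m ^ 2 + Y.a₂) ^ 2 - 3 * Y.a₄ - 3 * m * Y.a₃, ?_⟩
    simp only [WeierstrassCurve.c₄, WeierstrassCurve.b₂, WeierstrassCurve.b₄, hm]
    ring
  · refine Or.inr ⟨-16 * (m ^ 2 + m + Y.a₂) ^ 3 - 12 * (m ^ 2 + m + Y.a₂) ^ 2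
      - 3 * (m ^ 2 + m + Y.a₂) + 9 * ((2 * m + 1) ^ 2 + 4 * Y.a₂) * Y.b₄ - 54 * Y.b₆, ?_⟩
    simp only [WeierstrassCurve.c₆, WeierstrassCurve.b₂, hm]
    ring

/-- The norm of `2` in `ℚ₂` is `1/2`. [folklore] -/
theorem padic_norm_two : ‖(2 : ℚ_[2])‖ = 2⁻¹ := by
  simpa using Padic.norm_p (p := 2)

/-- A `2`-adic unit `η` has `η⁶ ≡ 1 (mod 4)` (`η = 2k + 1`, `η² = 1 + 4k(k+1)`). [folklore] -/
theorem four_dvd_pow_six_sub_one {η : ℤ_[2]} (hη : ‖η‖ = 1) : (4 : ℤ_[2]) ∣ η ^ 6 - 1 := by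
  obtain ⟨k, hk | hk⟩ := padicInt_two_exists_eq_two_mul_or η
  · exfalso
    -- `‖2‖ = 1/2` in `ℤ₂` (the tree's `Literature.NumberTheory.QuadraticFields.Sqrt41.norm_two_two`)
    have h2 : ‖(2 : ℤ_[2])‖ = 2⁻¹ := by simpa using PadicInt.norm_p (p := 2)
    have hle : ‖η‖ ≤ 2⁻¹ := by
      rw [hk, norm_mul, h2]
      exact mul_le_of_le_one_right (by norm_num) (PadicInt.norm_le_one k)
    rw [hη] at hle
    norm_num at hle
  · exact ⟨3 * (k ^ 2 + k) + 12 * (k ^ 2 + k) ^ 2 + 16 * (k ^ 2 + k) ^ 3, by rw [hk]; ring⟩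

/-- `‖k‖₂ ≤ 2⁻⁸` for an integer `k` means `2⁸ ∣ k`. [folklore] -/
theorem two_pow_eight_dvd_of_norm_le (k : ℤ) (hk : ‖(k : ℚ_[2])‖ ≤ 1 / 256) : (2 : ℤ) ^ 8 ∣ k := by
  have h := (Padic.norm_int_le_pow_iff_dvd (p := 2) k 8).mp (by
    have e : ((2 : ℕ) : ℝ) ^ (-(8 : ℕ) : ℤ) = 1 / 256 := by norm_num
    rw [e]; exact hk)
  exact_mod_cast h

/-! ### The Tate–Kraus step: `2⁸ ∤ c₄`, `2⁸ ∤ c₆ + 64` ⟹ minimal at `2` -/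

/-- **Minimality at `2` from Kraus's condition.** For `W₀ / ℤ` with `2⁸ ∤ c₄` and `2⁸ ∤ c₆ + 64`,
the equation `W₀ ⊗ ℚ₂` is a minimal Weierstrass equation over `ℤ₂` (Mathlib's
`WeierstrassCurve.IsMinimal`): an integral `ℚ₂`-isomorphic equation `C • W₀` with `ord₂ u⁻¹ ≥ 1`
has integral `c₄' = u⁻⁴ c₄`, `c₆' = u⁻⁶ c₆` (Silverman AEC VII.1.3), so `ord₂ u⁻¹ = -1` exactly
(else `2⁸ ∣ c₄`), and Kraus's necessary condition for `C • W₀` gives `2⁸ ∣ c₄` or `2⁸ ∣ c₆ + 64`.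
[cite: Kraus1989, Prop. 2] -/
theorem isMinimal_padic_two_of_kraus (W₀ : WeierstrassCurve ℤ)
    (h4 : ¬ (2 : ℤ) ^ 8 ∣ W₀.c₄) (h6 : ¬ (2 : ℤ) ^ 8 ∣ W₀.c₆ + 64) :
    ((W₀.baseChange ℚ).baseChange ℚ_[2]).IsMinimal ℤ_[2] := by
  set X := (W₀.baseChange ℚ).baseChange ℚ_[2] with hX
  have hV : ∀ x : ℚ_[2], NormedField.valuation x ≤ 1 ↔ x ∈ (algebraMap ℤ_[2] ℚ_[2]).range := by
    intro x
    rw [NormedField.valuation_apply, ← NNReal.coe_le_coe, coe_nnnorm, NNReal.coe_one]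
    constructor
    · intro hx
      exact ⟨⟨x, hx⟩, by rw [PadicInt.algebraMap_apply]⟩
    · rintro ⟨z, rfl⟩
      rw [PadicInt.algebraMap_apply, PadicInt.padic_norm_e_of_padicInt]
      exact PadicInt.norm_le_one z
  have hc₄X : X.c₄ = (W₀.c₄ : ℚ_[2]) := by
    simp [hX, WeierstrassCurve.baseChange, WeierstrassCurve.map_c₄]
  have hc₆X : X.c₆ = (W₀.c₆ : ℚ_[2]) := by
    simp [hX, WeierstrassCurve.baseChange, WeierstrassCurve.map_c₆]
  rw [isMinimal_iff_of_le_one_iff hV]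
  refine ⟨⟨⟨W₀.map (Int.castRingHom ℤ_[2]), ?_⟩⟩, fun C hC => ?_⟩
  · have hφ : (algebraMap ℚ ℚ_[2]).comp (algebraMap ℤ ℚ) =
        (algebraMap ℤ_[2] ℚ_[2]).comp (Int.castRingHom ℤ_[2]) := Subsingleton.elim _ _
    simp only [hX, WeierstrassCurve.baseChange, WeierstrassCurve.map_map, hφ]
  simp only [NormedField.valuation_apply, ← NNReal.coe_le_coe, coe_nnnorm, variableChange_Δ,
    norm_mul, norm_pow]
  set x : ℚ_[2] := ((C.u⁻¹ : ℚ_[2]ˣ) : ℚ_[2]) with hx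
  by_cases hx1 : ‖x‖ ≤ 1
  · exact mul_le_of_le_one_left (norm_nonneg _) (pow_le_one₀ (norm_nonneg _) hx1)
  exfalso
  rw [not_le] at hx1
  haveI := hC
  set Y := WeierstrassCurve.integralModel ℤ_[2] (C • X) with hY
  have hY4 : ((Y.c₄ : ℤ_[2]) : ℚ_[2]) = x ^ 4 * (W₀.c₄ : ℚ_[2]) := by
    rw [← PadicInt.algebraMap_apply, hY, WeierstrassCurve.integralModel_c₄_eq, variableChange_c₄,
      hc₄X]
  have hY6 : ((Y.c₆ : ℤ_[2]) : ℚ_[2]) = x ^ 6 * (W₀.c₆ : ℚ_[2]) := by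
    rw [← PadicInt.algebraMap_apply, hY, WeierstrassCurve.integralModel_c₆_eq, variableChange_c₆,
      hc₆X]
  have hx0 : x ≠ 0 := by
    intro h
    rw [h, norm_zero] at hx1
    exact absurd hx1 (by norm_num)
  -- `‖x‖ = 2 ^ e` with `e ≥ 1`
  have two_le : (2 : ℝ) ≤ ‖x‖ := by
    rw [Padic.norm_eq_zpow_neg_valuation hx0] at hx1 ⊢
    have he : 0 < -x.valuation := (one_lt_zpow_iff_right₀ (by norm_num : (1 : ℝ) < 2)).mp hx1
    calc (2 : ℝ) = 2 ^ (1 : ℤ) := by norm_num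
      _ ≤ 2 ^ (-x.valuation) := zpow_le_zpow_right₀ (by norm_num) (by omega)
  -- `c₄' = x⁴ c₄` is integral
  have hY4n : ‖x‖ ^ 4 * ‖(W₀.c₄ : ℚ_[2])‖ ≤ 1 := by
    rw [← norm_pow, ← norm_mul, ← hY4, PadicInt.padic_norm_e_of_padicInt]
    exact PadicInt.norm_le_one _
  rcases kraus_two_weak Y with ⟨w, hw⟩ | ⟨w, hw⟩
  · -- `16 ∣ c₄'`: then `2⁴ · ‖c₄‖ ≤ ‖x‖⁴ ‖c₄‖ = ‖16 w‖ ≤ 2⁻⁴`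
    apply h4
    apply two_pow_eight_dvd_of_norm_le
    have h16 : ‖x‖ ^ 4 * ‖(W₀.c₄ : ℚ_[2])‖ ≤ 1 / 16 := by
      rw [← norm_pow, ← norm_mul, ← hY4, hw, PadicInt.coe_mul, norm_mul,
        PadicInt.padic_norm_e_of_padicInt w]
      have e16 : ‖((16 : ℤ_[2]) : ℚ_[2])‖ = 1 / 16 := by
        have c16 : ((16 : ℤ_[2]) : ℚ_[2]) = 16 := by exact_mod_cast PadicInt.coe_natCast (p := 2) 16
        rw [c16, show (16 : ℚ_[2]) = 2 ^ 4 by norm_num, norm_pow, padic_norm_two]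
        norm_num
      rw [e16]
      calc 1 / 16 * ‖w‖ ≤ 1 / 16 * 1 := by gcongr; exact PadicInt.norm_le_one w
        _ = 1 / 16 := by ring
    have hpow : (16 : ℝ) ≤ ‖x‖ ^ 4 := by
      calc (16 : ℝ) = 2 ^ 4 := by norm_num
        _ ≤ ‖x‖ ^ 4 := pow_le_pow_left₀ (by norm_num) two_le 4
    have := le_trans (mul_le_mul_of_nonneg_right hpow (norm_nonneg _)) h16
    linarith
  · -- `4 ∣ c₆' + 1`: first `‖x‖ = 2`, i.e. `x = η / 2`, `η ∈ ℤ₂ˣ`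
    have hc4n : 1 / 256 < ‖(W₀.c₄ : ℚ_[2])‖ := by
      rw [← not_le]
      exact fun h => h4 (two_pow_eight_dvd_of_norm_le _ h)
    have x_le : ‖x‖ ≤ 2 := by
      have h4lt : ‖x‖ ^ 4 < 4 ^ 4 := by
        by_contra hge
        rw [not_lt] at hge
        have h256 : (256 : ℝ) * ‖(W₀.c₄ : ℚ_[2])‖ ≤ 1 :=
          le_trans (mul_le_mul_of_nonneg_right (by norm_num at hge ⊢; exact hge) (norm_nonneg _)) hY4n
        have : ‖(W₀.c₄ : ℚ_[2])‖ ≤ 1 / 256 := by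
          rw [le_div_iff₀ (by norm_num : (0 : ℝ) < 256)]; linarith
        linarith
      have hlt4 : ‖x‖ < 4 := lt_of_pow_lt_pow_left₀ 4 (by norm_num) h4lt
      rw [Padic.norm_eq_zpow_neg_valuation hx0] at hlt4 ⊢
      have hv : -x.valuation < 2 := by
        by_contra hge
        rw [not_lt] at hge
        have h' : (2 : ℝ) ^ (2 : ℤ) ≤ (2 : ℝ) ^ (-x.valuation) := zpow_le_zpow_right₀ (by norm_num) hge
        have h4' : (2 : ℝ) ^ (-x.valuation) < 4 := hlt4
        have e4 : (2 : ℝ) ^ (2 : ℤ) = 4 := by norm_num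
        linarith
      calc (2 : ℝ) ^ (-x.valuation) ≤ 2 ^ (1 : ℤ) := zpow_le_zpow_right₀ (by norm_num) (by omega)
        _ = 2 := by norm_num
    have x_eq : ‖x‖ = 2 := le_antisymm x_le two_le
    have hη1 : ‖(2 : ℚ_[2]) * x‖ = 1 := by rw [norm_mul, x_eq, padic_norm_two]; norm_num
    set η : ℤ_[2] := ⟨2 * x, hη1.le⟩ with hη
    have hηn : ‖η‖ = 1 := hη1
    obtain ⟨t, ht⟩ := four_dvd_pow_six_sub_one hηn
    -- `η⁶ (c₆ + 64) = 64 (x⁶ c₆ + 1) + 64 (η⁶ − 1) = 256 (w + t)`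
    have e1 : x ^ 6 * (W₀.c₆ : ℚ_[2]) + 1 = 4 * (w : ℚ_[2]) := by
      rw [← hY6]; exact_mod_cast congrArg ((↑) : ℤ_[2] → ℚ_[2]) hw
    have e2 : ((2 : ℚ_[2]) * x) ^ 6 - 1 = 4 * (t : ℚ_[2]) := by
      have := congrArg ((↑) : ℤ_[2] → ℚ_[2]) ht
      push_cast [hη] at this
      exact this
    have key : ((2 : ℚ_[2]) * x) ^ 6 * ((W₀.c₆ : ℚ_[2]) + 64) = 256 * ((w : ℚ_[2]) + t) := by
      linear_combination (64 : ℚ_[2]) * e1 + (64 : ℚ_[2]) * e2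
    apply h6
    apply two_pow_eight_dvd_of_norm_le
    have hn := congrArg norm key
    rw [norm_mul, norm_pow, hη1, one_pow, one_mul, norm_mul] at hn
    have e256 : ‖(256 : ℚ_[2])‖ = 1 / 256 := by
      rw [show (256 : ℚ_[2]) = 2 ^ 8 by norm_num, norm_pow, padic_norm_two]; norm_num
    have hwt : ‖(w : ℚ_[2]) + t‖ ≤ 1 := by
      rw [← PadicInt.coe_add, PadicInt.padic_norm_e_of_padicInt]; exact PadicInt.norm_le_one _
    push_cast
    rw [hn, e256]
    calc 1 / 256 * ‖(w : ℚ_[2]) + t‖ ≤ 1 / 256 * 1 := by gcongr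
      _ = 1 / 256 := by ring

/-- **Minimal at the place of `ℤ` over `2`** (the tree's `IsMinimalAt`, via the transport
`isMinimalAt_iff_isMinimal_padic`). [cite: Kraus1989, Prop. 2] -/
theorem isMinimalAt_baseChange_int_two_of_kraus (W₀ : WeierstrassCurve ℤ)
    (h4 : ¬ (2 : ℤ) ^ 8 ∣ W₀.c₄) (h6 : ¬ (2 : ℤ) ^ 8 ∣ W₀.c₆ + 64) {v : HeightOneSpectrum ℤ}
    (hv : Rat.HeightOneSpectrum.natGenerator v = 2) : (W₀.baseChange ℚ).IsMinimalAt v := by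
  haveI : Fact (Nat.Prime 2) := ⟨Nat.prime_two⟩
  exact (isMinimalAt_iff_isMinimal_padic v 2 hv _).mpr (isMinimal_padic_two_of_kraus W₀ h4 h6)

/-- **Global minimality with the Tate–Kraus step at `2`.** If `2⁸ ∤ c₄`, `2⁸ ∤ c₆ + 64`, and every
odd prime `q` has `q¹² ∤ Δ` or `q ∤ c₄`, then `W₀ ⊗ ℚ` is a global minimal equation (Silverman AEC
VIII.8: minimal at every prime). [cite: SilvermanAEC2009, VII.1 Remark 1.1] -/
theorem isGloballyMinimal_baseChange_int_of_kraus (W₀ : WeierstrassCurve ℤ)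
    (h4 : ¬ (2 : ℤ) ^ 8 ∣ W₀.c₄) (h6 : ¬ (2 : ℤ) ^ 8 ∣ W₀.c₆ + 64)
    (hmin : ∀ q : ℕ, q.Prime → q ≠ 2 → ¬ ((q : ℤ) ^ 12 ∣ W₀.Δ) ∨ ¬ ((q : ℤ) ∣ W₀.c₄)) :
    (W₀.baseChange ℚ).IsGloballyMinimal := by
  refine isGloballyMinimal_of_forall_isMinimalAt_int _ fun v => ?_
  by_cases hv : Rat.HeightOneSpectrum.natGenerator v = 2
  · exact isMinimalAt_baseChange_int_two_of_kraus W₀ h4 h6 hv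
  · rcases hmin _ (Rat.HeightOneSpectrum.prime_natGenerator v) hv with h | h
    · exact isMinimalAt_baseChange_int_of_not_pow_dvd_Δ h
    · exact isMinimalAt_baseChange_int_of_not_dvd_c₄ h

/-- **The odd-prime part is a finite check**: if `|Δ| < B¹²` and every odd prime `q < B` has
`q¹² ∤ |Δ|` or `q ∤ |c₄|`, then every odd prime does (for `q ≥ B`, `q¹² > |Δ|`). [folklore] -/
theorem forall_odd_not_pow_dvd_or_of_bound (W₀ : WeierstrassCurve ℤ) {B : ℕ}
    (hB : W₀.Δ.natAbs < B ^ 12) (hΔ : W₀.Δ ≠ 0)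
    (hdec : ∀ q ∈ Finset.range B, q.Prime → q ≠ 2 →
      ¬ (q ^ 12 ∣ W₀.Δ.natAbs) ∨ ¬ (q ∣ W₀.c₄.natAbs)) :
    ∀ q : ℕ, q.Prime → q ≠ 2 → ¬ ((q : ℤ) ^ 12 ∣ W₀.Δ) ∨ ¬ ((q : ℤ) ∣ W₀.c₄) := by
  intro q hq hq2
  have e12 : ((q : ℤ) ^ 12 ∣ W₀.Δ) ↔ q ^ 12 ∣ W₀.Δ.natAbs := by
    rw [← Int.natCast_dvd, Nat.cast_pow]
  have e1 : ((q : ℤ) ∣ W₀.c₄) ↔ q ∣ W₀.c₄.natAbs := Int.natCast_dvd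
  rw [e12, e1]
  by_cases hqB : q < B
  · exact hdec q (Finset.mem_range.mpr hqB) hq hq2
  · left
    intro h
    have hpos : 0 < W₀.Δ.natAbs := Int.natAbs_pos.mpr hΔ
    have hle : q ^ 12 ≤ W₀.Δ.natAbs := Nat.le_of_dvd hpos h
    have hBq : B ^ 12 ≤ q ^ 12 := Nat.pow_le_pow_left (not_lt.mp hqB) 12
    omega

/-- **The `2`-adic part is a finite check**: `2⁸ ∤ |c₄|` and `2⁸ ∤ |c₆ + 64|` in `ℕ`. [folklore] -/
theorem kraus_two_of_natAbs (W₀ : WeierstrassCurve ℤ) (h4 : ¬ 2 ^ 8 ∣ W₀.c₄.natAbs)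
    (h6 : ¬ 2 ^ 8 ∣ (W₀.c₆ + 64).natAbs) :
    ¬ (2 : ℤ) ^ 8 ∣ W₀.c₄ ∧ ¬ (2 : ℤ) ^ 8 ∣ W₀.c₆ + 64 := by
  refine ⟨fun h => h4 ?_, fun h => h6 ?_⟩
  · exact Int.natCast_dvd.mp (by exact_mod_cast h)
  · exact Int.natCast_dvd.mp (by exact_mod_cast h)

end Summit.BirchSwinnertonDyer.BirchSwinnertonDyer.Rank2Observatory
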